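import Literature.Probability.RandomPlanarGeometry.CaratheodoryContinuity
import Literature.Probability.RandomPlanarGeometry.ConformalMapRiemannProofs
import Literature.Probability.RandomPlanarGeometry.JordanDomainProofs
import HarnessLib

/-!
# Carathéodory boundary extension in the half-plane form and chordal uniformizing maps: discharges

Trunk T-STOCH (complex analysis). Unconditional proofs of the named facts of
`Literature/Probability/RandomPlanarGeometry/ConformalMap.lean` (half-plane Carathéodory facts)
and `Literature/Probability/RandomPlanarGeometry/ConformalRectangle.lean` (existence of chordal
uniformizing maps) that the chordal SLE files consume, assembled from theorems of the tree:

* Carathéodory's continuity theorem for Jordan domains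
  (`Literature.Probability.RandomPlanarGeometry.JordanDomain.exists_continuousOn_closedBall_extension_holds`,
  `CaratheodoryContinuity.lean`; Pommerenke (1992), Thm. 2.1, via length–area and Janiszewski),
* the half-plane reductions of `CaratheodoryHalfPlane.lean` (Cayley transform),
* the Riemann mapping theorem (`Literature.Probability.RandomPlanarGeometry.exists_conformalEquiv_ball_holds`,
  `ConformalMapRiemannProofs.lean` / `Literature.Analysis.Complex.RiemannMapping`),
* simple connectivity of Jordan domains (`Literature.Probability.RandomPlanarGeometry.JordanDomain.isSimplyConnected_holds`,
  `JordanDomainProofs.lean`, via Runge's theorem).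

Results (all `theorem … _holds : <named fact>`):
`JordanDomain.continuousOn_boundaryExtension_holds`, `JordanDomain.mapsTo_boundaryExtension_holds`,
`JordanDomain.exists_hasBoundaryValue_holds`, `JordanDomain.exists_hasBoundaryValueAtInfty_holds`
(Pommerenke Thm. 2.1 in half-plane form) and `MarkedDomain.exists_isChordalUniformizing_holds`
(every Dobrushin domain `(D; a, b)` is the conformal image of `(ℍₒ; 0, ∞)` with the prescribed
boundary values; Ahlfors (1979), Ch. 6 §1.1 + Pommerenke Thm. 2.1). None uses the Jordan curve
theorem.

## References

* Ch. Pommerenke, *Boundary Behaviour of Conformal Maps*, Springer (1992), Thm. 2.1.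
* L. V. Ahlfors, *Complex Analysis*, 3rd ed. (1979), Ch. 6 §1.1, Thm. 1.
-/

noncomputable section

open Set Filter Metric Topology Complex

namespace Literature.Probability.RandomPlanarGeometry

namespace JordanDomain

/-- **Carathéodory, half-plane form (continuity), proved**: the boundary extension of a conformal
equivalence `φ : ℍₒ → D` onto a Jordan domain is continuous on the closed upper half-plane.
Pommerenke (1992), Thm. 2.1 (via the Cayley transform). [cite: PommerenkeBBCM1992, Thm. 2.1] -/
theorem continuousOn_boundaryExtension_holds : continuousOn_boundaryExtension :=
  continuousOn_boundaryExtension_of_closedBall exists_continuousOn_closedBall_extension_holds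

/-- **Carathéodory, half-plane form, proved**: the boundary extension maps the closed upper
half-plane into `closure D`. Pommerenke (1992), Thm. 2.1. [cite: PommerenkeBBCM1992, Thm. 2.1] -/
theorem mapsTo_boundaryExtension_holds : mapsTo_boundaryExtension :=
  mapsTo_boundaryExtension_of_closedBall exists_continuousOn_closedBall_extension_holds

/-- **Carathéodory, half-plane form, proved**: boundary values on `∂D` at every real point.
Pommerenke (1992), Thm. 2.1. [cite: PommerenkeBBCM1992, Thm. 2.1] -/
theorem exists_hasBoundaryValue_holds : exists_hasBoundaryValue :=
  exists_hasBoundaryValue_of_closedBall exists_continuousOn_closedBall_extension_holds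

/-- **Carathéodory, half-plane form, proved**: a boundary value on `∂D` at infinity.
Pommerenke (1992), Thm. 2.1. [cite: PommerenkeBBCM1992, Thm. 2.1] -/
theorem exists_hasBoundaryValueAtInfty_holds : exists_hasBoundaryValueAtInfty :=
  exists_hasBoundaryValueAtInfty_of_closedBall exists_continuousOn_closedBall_extension_holds

end JordanDomain

/-- **Existence of chordal uniformizing maps, proved**: every Dobrushin domain `(D; a, b)` is the
image of `(ℍₒ; 0, ∞)` under a conformal equivalence with boundary value `a` at `0` and `b` at
`∞` — from the Riemann mapping theorem (`exists_conformalEquiv_ball_holds`), simple connectivity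
of Jordan domains (`JordanDomain.isSimplyConnected_holds`) and Carathéodory's continuity theorem
(`JordanDomain.exists_continuousOn_closedBall_extension_holds`), by
`MarkedDomain.exists_isChordalUniformizing_of_closedBall`. Ahlfors (1979), Ch. 6 §1.1, Thm. 1;
Pommerenke (1992), Thm. 2.1. [cite: AhlforsCA1979, Ch. 6 §1.1 Thm. 1] -/
theorem MarkedDomain.exists_isChordalUniformizing_holds : MarkedDomain.exists_isChordalUniformizing :=
  MarkedDomain.exists_isChordalUniformizing_of_closedBall JordanDomain.isSimplyConnected_holds
    exists_conformalEquiv_ball_holds JordanDomain.exists_continuousOn_closedBall_extension_holds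

end Literature.Probability.RandomPlanarGeometry
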